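import Mathlib
import Summits.ResolutionOfSingularities.ResolutionOfSingularities.Theorems.WildQuotientsWildQuotientResolutionPthConeFanExponents

/-!
# The toric fan ideal `𝔞_{a,b}`: the generators lie in the Newton polyhedron (facet inequalities)
(crux stmt-ResolutionOfSingularities-15640 `WildQuotients.WildQuotientResolution`, line `Sketch`;
chain w45c POST-V5 S2 brick F6 `…ConductorOneToricFan` = toric brick `T(a,b)` of res-L1-w45c-lead-1's
`S2-DESIGN.md` §3 / §7 (7.6). [OURS · L1 W4.5c] — NOT a statement of any manuscript; replaces the role of
no printed item. Owner res-L1-w45c-stub-4 (gen 5).)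

With `X(κ) = Σ_{l ∈ A} d_l`, `Y(κ) = Σ_{l ∉ A} d_l` for the exponent `d = fanExp κ` of a fan generator, the
scaled pairing with the interior ray `v_j = (j/p)𝟙_A + ((p−j)/p)𝟙_{Aᶜ}` is `jX + (p−j)Y`, and the
support function of the fan ideal is `ψ(v_j) = j(p−j)`:
* `PthCone.sumA_two / sumA_three`, `PthCone.cast_vtx / cast_q` — bookkeeping;
* `PthCone.pairing_fanExp_ge` — **facet inequalities** `jX + (p−j)Y ≥ p j (p−j)` for every integer `j ≤ p`
  (the difference is `p·(square)` or `p·x(x+1)`), i.e. every generator lies in the Newton polyhedron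
  `P_ψ` whose vertices are the `x_ρ^{(p−j)(p−j−1)}x_{ρ'}^{j(j+1)}`.
-/

set_option linter.dupNamespace false

noncomputable section

open MvPolynomial

namespace Summit.ResolutionOfSingularities.ResolutionOfSingularities.Theorems.WildQuotientResolution.PthCone

variable {n p : ℕ} {A : Finset (Fin n)}

/-! ## Partial degrees of the generators -/

section Sums

variable (A)

/-- `Σ_{l ∈ A}` of a sum of three singles. [folklore] -/
theorem sumA_three (ρ σ τ : Fin n) (x y z : ℕ) :
    ∑ l ∈ A, (Finsupp.single ρ x + Finsupp.single σ y + Finsupp.single τ z) l =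
      (∑ l ∈ A, Finsupp.single ρ x l) + (∑ l ∈ A, Finsupp.single σ y l) + ∑ l ∈ A, Finsupp.single τ z l := by
  simp only [Finsupp.coe_add, Pi.add_apply, Finset.sum_add_distrib]

/-- `Σ_{l ∈ A}` of a sum of two singles. [folklore] -/
theorem sumA_two (ρ σ : Fin n) (x y : ℕ) :
    ∑ l ∈ A, (Finsupp.single ρ x + Finsupp.single σ y) l =
      (∑ l ∈ A, Finsupp.single ρ x l) + ∑ l ∈ A, Finsupp.single σ y l := by
  simp only [Finsupp.coe_add, Pi.add_apply, Finset.sum_add_distrib]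

end Sums

/-- `x(x+1) ≥ 0` for every integer `x`. [folklore] -/
theorem int_mul_add_one_nonneg (x : ℤ) : 0 ≤ x * (x + 1) := by
  rcases le_or_gt 0 x with h | h
  · positivity
  · nlinarith

/-- Cast of `(p−j)(p−j−1)` for `j + 1 ≤ p`. [folklore] -/
theorem cast_vtx (j : ℕ) (hj : j + 1 ≤ p) :
    (((p - j) * (p - j - 1) : ℕ) : ℤ) = ((p : ℤ) - j) * ((p : ℤ) - j - 1) := by
  rw [Nat.cast_mul, Nat.cast_sub (by omega), Nat.cast_sub (by omega), Nat.cast_sub (by omega)]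
  push_cast; ring

/-- Cast of `(p−i)²` for `i ≤ p`. [folklore] -/
theorem cast_q (i : ℕ) (hi : i ≤ p) : (((p - i) ^ 2 : ℕ) : ℤ) = ((p : ℤ) - i) ^ 2 := by
  rw [Nat.cast_pow, Nat.cast_sub hi]

variable [hp : Fact p.Prime]

/-- **Facet inequalities.** For every fan generator with exponent `d` and every integer `j ≤ p`:
`j·Σ_A d + (p−j)·Σ_{Aᶜ} d ≥ p j (p−j)`. [OURS · L1 W4.5c] -/
theorem pairing_fanExp_ge (κ : FIdx n p A) (j : ℤ) (hjp : j ≤ p) :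
    (p : ℤ) * j * ((p : ℤ) - j) ≤
      j * (∑ l ∈ A, (fanExp n p A κ l : ℤ)) + ((p : ℤ) - j) * ∑ l ∈ Aᶜ, (fanExp n p A κ l : ℤ) := by
  classical
  have hp2 : 2 ≤ p := hp.out.two_le
  have hp0 : (0 : ℤ) ≤ p := by positivity
  have hpj : (0 : ℤ) ≤ (p : ℤ) - j := by linarith
  have c1 : ((p - 1 : ℕ) : ℤ) = (p : ℤ) - 1 := by rw [Nat.cast_sub (by omega), Nat.cast_one]
  have cpp : ((p * (p - 1) : ℕ) : ℤ) = (p : ℤ) * (p - 1) := by rw [Nat.cast_mul, c1]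
  have cpp1 : ((p * (p - 1) - 1 : ℕ) : ℤ) = (p : ℤ) * (p - 1) - 1 := by
    rw [Nat.cast_sub (Nat.one_le_iff_ne_zero.mpr (Nat.mul_ne_zero (by omega) (by omega))), cpp,
      Nat.cast_one]
  have csq : (((p - 1) ^ 2 : ℕ) : ℤ) = ((p : ℤ) - 1) ^ 2 := by rw [Nat.cast_pow, c1]
  rw [← Nat.cast_sum, ← Nat.cast_sum]
  -- membership bookkeeping
  have mA : ∀ ρ : A, (ρ : Fin n) ∈ A := fun ρ => ρ.2
  have nA : ∀ ρ' : (Aᶜ : Finset (Fin n)), (ρ' : Fin n) ∉ A := fun ρ' => Finset.mem_compl.mp ρ'.2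
  have mB : ∀ ρ' : (Aᶜ : Finset (Fin n)), (ρ' : Fin n) ∈ Aᶜ := fun ρ' => ρ'.2
  have nB : ∀ ρ : A, (ρ : Fin n) ∉ Aᶜ := fun ρ => Finset.notMem_compl.mpr ρ.2
  rcases κ with (((ρ | ρ) | (⟨ρ, l⟩ | ⟨ρ, l'⟩)) | ((ρ' | ρ') | (⟨ρ', l'⟩ | ⟨ρ', l⟩))) |
    ((⟨jj, ρ, ρ'⟩ | ⟨ii, ρ, ρ'⟩) | (⟨jj, ρ, ρ', l⟩ | ⟨jj, ρ, ρ', l'⟩))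
  · -- v0
    change (p : ℤ) * j * (p - j) ≤ j * ((∑ l ∈ A, Finsupp.single (ρ : Fin n) (p * (p - 1)) l : ℕ) : ℤ) +
      (p - j) * ((∑ l ∈ Aᶜ, Finsupp.single (ρ : Fin n) (p * (p - 1)) l : ℕ) : ℤ)
    rw [sum_single_apply_of_mem n (mA ρ), sum_single_apply_of_not_mem n (nB ρ), cpp, Nat.cast_zero]
    nlinarith [mul_nonneg hp0 (int_mul_add_one_nonneg (j - 1))]
  · -- q0
    change (p : ℤ) * j * (p - j) ≤ j * ((∑ l ∈ A, Finsupp.single (ρ : Fin n) (p ^ 2) l : ℕ) : ℤ) +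
      (p - j) * ((∑ l ∈ Aᶜ, Finsupp.single (ρ : Fin n) (p ^ 2) l : ℕ) : ℤ)
    rw [sum_single_apply_of_mem n (mA ρ), sum_single_apply_of_not_mem n (nB ρ), Nat.cast_pow, Nat.cast_zero]
    nlinarith [mul_nonneg hp0 (sq_nonneg j)]
  · -- e0
    change (p : ℤ) * j * (p - j) ≤
      j * ((∑ i ∈ A, (Finsupp.single (ρ : Fin n) (p * (p - 1) - 1) + Finsupp.single (l : Fin n) 1 : Fin n →₀ ℕ) i : ℕ) : ℤ) +
      (p - j) * ((∑ i ∈ Aᶜ, (Finsupp.single (ρ : Fin n) (p * (p - 1) - 1) + Finsupp.single (l : Fin n) 1 : Fin n →₀ ℕ) i : ℕ) : ℤ)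
    rw [sumA_two, sumA_two, sum_single_apply_of_mem n (mA ρ), sum_single_apply_of_mem n (mA l),
      sum_single_apply_of_not_mem n (nB ρ), sum_single_apply_of_not_mem n (nB l), Nat.cast_add, cpp1]
    push_cast
    nlinarith [mul_nonneg hp0 (int_mul_add_one_nonneg (j - 1))]
  · -- x0
    change (p : ℤ) * j * (p - j) ≤
      j * ((∑ i ∈ A, (Finsupp.single (ρ : Fin n) ((p - 1) ^ 2) + Finsupp.single (l' : Fin n) 1 : Fin n →₀ ℕ) i : ℕ) : ℤ) +
      (p - j) * ((∑ i ∈ Aᶜ, (Finsupp.single (ρ : Fin n) ((p - 1) ^ 2) + Finsupp.single (l' : Fin n) 1 : Fin n →₀ ℕ) i : ℕ) : ℤ)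
    rw [sumA_two, sumA_two, sum_single_apply_of_mem n (mA ρ), sum_single_apply_of_not_mem n (nA l'),
      sum_single_apply_of_not_mem n (nB ρ), sum_single_apply_of_mem n (mB l'), Nat.cast_add, Nat.cast_add,
      csq]
    push_cast
    nlinarith [mul_nonneg hp0 (sq_nonneg (j - 1))]
  · -- vp
    change (p : ℤ) * j * (p - j) ≤ j * ((∑ l ∈ A, Finsupp.single (ρ' : Fin n) (p * (p - 1)) l : ℕ) : ℤ) +
      (p - j) * ((∑ l ∈ Aᶜ, Finsupp.single (ρ' : Fin n) (p * (p - 1)) l : ℕ) : ℤ)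
    rw [sum_single_apply_of_not_mem n (nA ρ'), sum_single_apply_of_mem n (mB ρ'), cpp, Nat.cast_zero]
    nlinarith [mul_nonneg hp0 (int_mul_add_one_nonneg ((p : ℤ) - 1 - j))]
  · -- qp
    change (p : ℤ) * j * (p - j) ≤ j * ((∑ l ∈ A, Finsupp.single (ρ' : Fin n) (p ^ 2) l : ℕ) : ℤ) +
      (p - j) * ((∑ l ∈ Aᶜ, Finsupp.single (ρ' : Fin n) (p ^ 2) l : ℕ) : ℤ)
    rw [sum_single_apply_of_not_mem n (nA ρ'), sum_single_apply_of_mem n (mB ρ'), Nat.cast_pow, Nat.cast_zero]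
    nlinarith [mul_nonneg hp0 (sq_nonneg ((p : ℤ) - j))]
  · -- ep
    change (p : ℤ) * j * (p - j) ≤
      j * ((∑ i ∈ A, (Finsupp.single (ρ' : Fin n) (p * (p - 1) - 1) + Finsupp.single (l' : Fin n) 1 : Fin n →₀ ℕ) i : ℕ) : ℤ) +
      (p - j) * ((∑ i ∈ Aᶜ, (Finsupp.single (ρ' : Fin n) (p * (p - 1) - 1) + Finsupp.single (l' : Fin n) 1 : Fin n →₀ ℕ) i : ℕ) : ℤ)
    rw [sumA_two, sumA_two, sum_single_apply_of_not_mem n (nA ρ'), sum_single_apply_of_not_mem n (nA l'),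
      sum_single_apply_of_mem n (mB ρ'), sum_single_apply_of_mem n (mB l'), Nat.cast_add, Nat.cast_add, cpp1]
    push_cast
    nlinarith [mul_nonneg hp0 (int_mul_add_one_nonneg ((p : ℤ) - 1 - j))]
  · -- xp
    change (p : ℤ) * j * (p - j) ≤
      j * ((∑ i ∈ A, (Finsupp.single (ρ' : Fin n) ((p - 1) ^ 2) + Finsupp.single (l : Fin n) 1 : Fin n →₀ ℕ) i : ℕ) : ℤ) +
      (p - j) * ((∑ i ∈ Aᶜ, (Finsupp.single (ρ' : Fin n) ((p - 1) ^ 2) + Finsupp.single (l : Fin n) 1 : Fin n →₀ ℕ) i : ℕ) : ℤ)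
    rw [sumA_two, sumA_two, sum_single_apply_of_not_mem n (nA ρ'), sum_single_apply_of_mem n (mA l),
      sum_single_apply_of_mem n (mB ρ'), sum_single_apply_of_not_mem n (nB l), Nat.cast_add, Nat.cast_add,
      csq]
    push_cast
    nlinarith [mul_nonneg hp0 (sq_nonneg ((p : ℤ) - 1 - j))]
  · -- vm
    have hjj : (jj : ℕ) + 3 ≤ p := by have := jj.2; omega
    change (p : ℤ) * j * (p - j) ≤
      j * ((∑ i ∈ A, vtxExp n p ((jj : ℕ) + 1) ρ ρ' i : ℕ) : ℤ) +
      (p - j) * ((∑ i ∈ Aᶜ, vtxExp n p ((jj : ℕ) + 1) ρ ρ' i : ℕ) : ℤ)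
    rw [vtxExp, sumA_two, sumA_two, sum_single_apply_of_mem n (mA ρ), sum_single_apply_of_not_mem n (nA ρ'),
      sum_single_apply_of_not_mem n (nB ρ), sum_single_apply_of_mem n (mB ρ'), add_zero, zero_add,
      cast_vtx _ (by omega)]
    push_cast
    nlinarith [mul_nonneg hp0 (int_mul_add_one_nonneg (((jj : ℕ) : ℤ) + 1 - j))]
  · -- qm
    have hii : (ii : ℕ) + 2 ≤ p := by have := ii.2; omega
    change (p : ℤ) * j * (p - j) ≤
      j * ((∑ i ∈ A, qExp n p ((ii : ℕ) + 1) ρ ρ' i : ℕ) : ℤ) +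
      (p - j) * ((∑ i ∈ Aᶜ, qExp n p ((ii : ℕ) + 1) ρ ρ' i : ℕ) : ℤ)
    rw [qExp, sumA_two, sumA_two, sum_single_apply_of_mem n (mA ρ), sum_single_apply_of_not_mem n (nA ρ'),
      sum_single_apply_of_not_mem n (nB ρ), sum_single_apply_of_mem n (mB ρ'), add_zero, zero_add,
      cast_q _ (by omega)]
    push_cast
    nlinarith [mul_nonneg hp0 (sq_nonneg (((ii : ℕ) : ℤ) + 1 - j))]
  · -- ea
    have hjj : (jj : ℕ) + 3 ≤ p := by have := jj.2; omega
    have h1 : 1 ≤ (p - ((jj : ℕ) + 1)) * (p - ((jj : ℕ) + 1) - 1) :=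
      Nat.one_le_iff_ne_zero.mpr (Nat.mul_ne_zero (by omega) (by omega))
    change (p : ℤ) * j * (p - j) ≤
      j * ((∑ i ∈ A, (Finsupp.single (ρ : Fin n) ((p - ((jj : ℕ) + 1)) * (p - ((jj : ℕ) + 1) - 1) - 1) +
        Finsupp.single (ρ' : Fin n) (((jj : ℕ) + 1) * ((jj : ℕ) + 2)) + Finsupp.single (l : Fin n) 1 : Fin n →₀ ℕ) i : ℕ) : ℤ) +
      (p - j) * ((∑ i ∈ Aᶜ, (Finsupp.single (ρ : Fin n) ((p - ((jj : ℕ) + 1)) * (p - ((jj : ℕ) + 1) - 1) - 1) +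
        Finsupp.single (ρ' : Fin n) (((jj : ℕ) + 1) * ((jj : ℕ) + 2)) + Finsupp.single (l : Fin n) 1 : Fin n →₀ ℕ) i : ℕ) : ℤ)
    rw [sumA_three, sumA_three, sum_single_apply_of_mem n (mA ρ), sum_single_apply_of_not_mem n (nA ρ'),
      sum_single_apply_of_mem n (mA l), sum_single_apply_of_not_mem n (nB ρ),
      sum_single_apply_of_mem n (mB ρ'), sum_single_apply_of_not_mem n (nB l), add_zero, zero_add, add_zero,
      Nat.sub_add_cancel h1, cast_vtx _ (by omega)]
    push_cast
    nlinarith [mul_nonneg hp0 (int_mul_add_one_nonneg (((jj : ℕ) : ℤ) + 1 - j))]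
  · -- eb
    have hjj : (jj : ℕ) + 3 ≤ p := by have := jj.2; omega
    have h1 : 1 ≤ ((jj : ℕ) + 1) * ((jj : ℕ) + 2) :=
      Nat.one_le_iff_ne_zero.mpr (Nat.mul_ne_zero (by omega) (by omega))
    change (p : ℤ) * j * (p - j) ≤
      j * ((∑ i ∈ A, (Finsupp.single (ρ : Fin n) ((p - ((jj : ℕ) + 1)) * (p - ((jj : ℕ) + 1) - 1)) +
        Finsupp.single (ρ' : Fin n) (((jj : ℕ) + 1) * ((jj : ℕ) + 2) - 1) + Finsupp.single (l' : Fin n) 1 : Fin n →₀ ℕ) i : ℕ) : ℤ) +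
      (p - j) * ((∑ i ∈ Aᶜ, (Finsupp.single (ρ : Fin n) ((p - ((jj : ℕ) + 1)) * (p - ((jj : ℕ) + 1) - 1)) +
        Finsupp.single (ρ' : Fin n) (((jj : ℕ) + 1) * ((jj : ℕ) + 2) - 1) + Finsupp.single (l' : Fin n) 1 : Fin n →₀ ℕ) i : ℕ) : ℤ)
    rw [sumA_three, sumA_three, sum_single_apply_of_mem n (mA ρ), sum_single_apply_of_not_mem n (nA ρ'),
      sum_single_apply_of_not_mem n (nA l'), sum_single_apply_of_not_mem n (nB ρ),
      sum_single_apply_of_mem n (mB ρ'), sum_single_apply_of_mem n (mB l'), add_zero, add_zero, zero_add,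
      Nat.sub_add_cancel h1, cast_vtx _ (by omega)]
    push_cast
    nlinarith [mul_nonneg hp0 (int_mul_add_one_nonneg (((jj : ℕ) : ℤ) + 1 - j))]

end Summit.ResolutionOfSingularities.ResolutionOfSingularities.Theorems.WildQuotientResolution.PthCone

end
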